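import Literature.AlgebraicGeometry.Motives.HypersurfaceSplitLinearSections
import Literature.AlgebraicGeometry.Motives.LinesGenerateChowOneSumSq
import Literature.RingTheory.MvPolynomial.CubicFormPlaneChains
import HarnessLib

/-!
# An osculating line meets the hypersurface in its point of contact with multiplicity the degree

R. Mboro, *Remarks on the `CH₂` of cubic hypersurfaces* (arXiv:1701.04488), proof of Thm. 1.2,
Case 2 (p. 7): "for the general point `x ∈ Σ`, the line `φ ∘ σ(x)` is not contained in `X`,
hence intersects `X` at `x` with multiplicity `d`" — the osculating lines of Lemma 1.1 (p. 6:
"the line `l` is osculating if and only if `f_j(Y) = 0` for all `j < d`", i.e. the restriction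
of the equation of `X` to `l` is `f_d(Y) λ_x^d`). This file proves the corresponding identity of
intersection CYCLES on `ℙᴺ_K` over an arbitrary infinite field `K` (in the application `K = k(S)`
is the function field of the surface `Σ` and the line is the osculating `K`-line through its
generic point), for `d = 3`:

* `ProjSpace.eval_add_smul_of_isHomogeneous_one` — linear forms are linear;
* `ProjSpace.exists_linearForm_eval_eq_zero_ne_zero` — for independent `x, y ∈ Kᴺ⁺¹` a linear
  form `λ` with `λ(x) = 0 ≠ λ(y)`;
* `ProjSpace.eq_pt_pointOfVec_of_mem_zeroLocus_line` — a point of the line `V₊(μ)` through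
  `[x], [y]` at which such a `λ` vanishes is the `K`-point `[x]`;
* `ProjSpace.primeInter_formDivisor_linear_line_eq_primeCycle` — **`V₊(λ) · [V₊(μ)] = [[x]]`** for
  a linear `λ` with `λ(x) = 0 ≠ λ(y)` (multiplicity one: `Motives/ProjectiveSpaceHyperplaneMultiplicity`);
* `ProjSpace.primeInter_formDivisor_line_eq_three_smul` — **for a cubic form `F` with
  `F(s x + t y) = t³ F(y)` (the line `[x][y]` osculates `V₊(F)` at `[x]`) and `F(y) ≠ 0`:
  `V₊(F) · [V₊(μ)] = 3 · [[x]]`** as cycles on `ℙᴺ_K` (`F ≡ c λ³ mod 𝔭_{V₊(μ)}`, `c = F(y)/λ(y)³`,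
  so `V₊(F) · [V₊(μ)] = V₊(c λ · λ · λ) · [V₊(μ)] = 3 V₊(λ) · [V₊(μ)]` by
  `primeInter_formDivisor_congr` / `primeInter_formDivisor_mul` of
  `Motives/HypersurfaceSplitLinearSections`).

Everything is proved; no named facts.

## References

* [Mboro2018] R. Mboro, Remarks on the CH₂ of cubic hypersurfaces, Geom. Dedicata 200 (2018) =
  arXiv:1701.04488, Lemma 1.1 (p. 6) and proof of Thm. 1.2, Case 2 (p. 7).
* [Fulton1998] W. Fulton, Intersection Theory, 2nd ed. (1998), Def. 2.3, Prop. 2.3 (b),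
  Example 2.5.1.
-/

noncomputable section

open CategoryTheory AlgebraicGeometry Order MvPolynomial
open Literature.AlgebraicGeometry.Motives.Segre

universe u

namespace Literature.AlgebraicGeometry.Motives

attribute [local instance] MvPolynomial.gradedAlgebra

namespace ProjSpace

open ProjFamily ProjectiveSpace ProjectiveSpaceCells Literature.RingTheory.MvPolynomial

variable {K : Type u} [Field K] {N : ℕ}

/-! ### Linear forms are linear -/

/-- `(lin v)(w) = Σ_j v_j w_j`. [folklore] -/
theorem eval_lin_eq_sum' (v w : Fin (N + 1) → K) : eval w (lin v) = ∑ j, v j * w j := by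
  simp only [lin, map_sum, MvPolynomial.smul_eq_C_mul, map_mul, eval_C, eval_X]

/-- **Linear forms are linear**: `φ(s x + t y) = s φ(x) + t φ(y)` for `φ` homogeneous of degree
`1`. [folklore] -/
theorem eval_add_smul_of_isHomogeneous_one {φ : MvPolynomial (Fin (N + 1)) K}
    (hφ : φ.IsHomogeneous 1) (s t : K) (x y : Fin (N + 1) → K) :
    eval (s • x + t • y) φ = s * eval x φ + t * eval y φ := by
  rw [eq_lin_of_isHomogeneous_one hφ]
  simp only [eval_lin_eq_sum', Pi.add_apply, Pi.smul_apply, smul_eq_mul, Finset.mul_sum,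
    ← Finset.sum_add_distrib]
  exact Finset.sum_congr rfl fun j _ => by ring

/-- A form in the ideal of the line forms `μ` of `span(x, y)` vanishes at `y` (and at `x`).
[folklore] -/
theorem eval_eq_zero_of_mem_idealSpan {μ : Fin (N - 1) → MvPolynomial (Fin (N + 1)) K}
    {v : Fin (N + 1) → K} (hμv : ∀ l, eval v (μ l) = 0) {G : MvPolynomial (Fin (N + 1)) K}
    (hG : G ∈ Ideal.span (Set.range μ)) : eval v G = 0 := by
  classical
  obtain ⟨cf, hcf⟩ := Ideal.mem_span_range_iff_exists_fun.1 hG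
  rw [← hcf, map_sum]
  refine Finset.sum_eq_zero fun l _ => ?_
  rw [map_mul, hμv l, mul_zero]

/-! ### A linear form vanishing at `x` but not at `y` -/

variable [Infinite K]

/-- For linearly independent `x, y ∈ Kᴺ⁺¹` there is a linear form `λ` with `λ(x) = 0` and
`λ(y) ≠ 0` (among the `N` independent linear forms cutting out the point `[x]`: they cannot all
vanish at `y`, since the linear forms vanishing on the `2`-plane `span(x, y)` lie in the span of its
`N - 1` line forms). [folklore] -/
theorem exists_linearForm_eval_eq_zero_ne_zero (hN : 1 ≤ N) {x y : Fin (N + 1) → K}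
    (hxy : LinearIndependent K ![x, y]) :
    ∃ lam : MvPolynomial (Fin (N + 1)) K, lam.IsHomogeneous 1 ∧ eval x lam = 0 ∧ eval y lam ≠ 0 := by
  classical
  have hx0 : x ≠ 0 := by simpa using hxy.ne_zero 0
  have hx : LinearIndependent K ![x] := by
    rw [linearIndependent_unique_iff]; exact hx0
  obtain ⟨t, L, htu, hLlin, hLhom, hLvan, -⟩ := exists_linearForms_forall_mem_ideal_span_vanishing hx
  obtain ⟨μ, hμli, hμhom, hμv, hμideal⟩ := exists_lineForms ![x, y] hxy hN
  by_contra hall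
  simp only [not_exists, not_and, not_not] at hall
  -- every `L j` vanishes on `span(x, y)`, hence lies in the `K`-span of the `μ l`
  have hxspan : x ∈ Submodule.span K (Set.range ![x]) := Submodule.subset_span ⟨0, rfl⟩
  have hmem : ∀ j, L j ∈ Submodule.span K (Set.range μ) := by
    intro j
    have hxj : eval x (L j) = 0 := hLvan j x hxspan
    have hyj : eval y (L j) = 0 := hall (L j) (hLhom j) hxj
    have hvan : ∀ s t : K, eval (s • (![x, y] 0) + t • (![x, y] 1)) (L j) = 0 := by
      intro s t
      simp only [Matrix.cons_val_zero, Matrix.cons_val_one]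
      rw [eval_add_smul_of_isHomogeneous_one (hLhom j), hxj, hyj, mul_zero, mul_zero, add_zero]
    exact mem_span_of_mem_idealSpan_of_linear μ hμhom (hμideal _ hvan) (hLhom j)
  -- dimension count: `t = N` independent vectors inside a space of dimension `≤ N - 1`
  have hle : Submodule.span K (Set.range L) ≤ Submodule.span K (Set.range μ) :=
    Submodule.span_le.mpr (by rintro _ ⟨j, rfl⟩; exact hmem j)
  have h1 : Module.finrank K (Submodule.span K (Set.range L)) = t := by
    rw [finrank_span_eq_card hLlin, Fintype.card_fin]
  have h2 : Module.finrank K (Submodule.span K (Set.range μ)) ≤ N - 1 := by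
    have h := finrank_range_le_card (R := K) μ
    rwa [Fintype.card_fin] at h
  haveI : Module.Finite K (Submodule.span K (Set.range μ)) :=
    FiniteDimensional.span_of_finite K (Set.finite_range μ)
  have h3 := Submodule.finrank_mono hle
  rw [h1] at h3
  omega

/-! ### The point of the line at which `λ` vanishes -/

omit [Infinite K] in
/-- On the line `V₊(μ)` through `[x]` and `[y]`, **the only point at which a linear form `λ` with
`λ(x) = 0 ≠ λ(y)` vanishes is `[x]`**: such a point lies on `V₊(μ, λ)`, the zero locus of `N`
independent linear forms, which is the single `K`-point `[x]`. [folklore] -/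
theorem eq_pt_pointOfVec_of_mem_zeroLocus_line (hN : 1 ≤ N) {x y : Fin (N + 1) → K}
    (hx0 : x ≠ 0) {μ : Fin (N - 1) → MvPolynomial (Fin (N + 1)) K} (hμli : LinearIndependent K μ)
    (hμhom : ∀ l, (μ l).IsHomogeneous 1) (hμx : ∀ l, eval x (μ l) = 0) (hμy : ∀ l, eval y (μ l) = 0)
    {lam : MvPolynomial (Fin (N + 1)) K} (hlam : lam.IsHomogeneous 1) (hlamx : eval x lam = 0)
    (hlamy : eval y lam ≠ 0) {z : ↥(projectiveSpace N K).left}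
    (hz : z ∈ ProjectiveSpectrum.zeroLocus (MvPolynomial.homogeneousSubmodule (Fin (N + 1)) K)
      (Set.range μ))
    (hlamz : lam ∈ ProjectiveSpectrum.asHomogeneousIdeal
      (𝒜 := MvPolynomial.homogeneousSubmodule (Fin (N + 1)) K) z) :
    z = (pointOfVec K x hx0).pt := by
  classical
  -- the `N` forms `(μ, λ)` are independent: `λ ∉ span μ` since `λ(y) ≠ 0`
  set L : Fin (N - 1 + 1) → MvPolynomial (Fin (N + 1)) K := Fin.snoc μ lam with hL
  have hLlast : L (Fin.last (N - 1)) = lam := by simp [hL]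
  have hLcast : ∀ i : Fin (N - 1), L i.castSucc = μ i := fun i => by simp [hL]
  have hLhom : ∀ j, (L j).IsHomogeneous 1 := by
    intro j
    refine Fin.lastCases ?_ (fun i => ?_) j
    · rw [hLlast]; exact hlam
    · rw [hLcast]; exact hμhom i
  have hLlin : LinearIndependent K L := by
    rw [hL, linearIndependent_finSnoc]
    refine ⟨hμli, fun hmem => hlamy ?_⟩
    obtain ⟨c, hc⟩ := (Submodule.mem_span_range_iff_exists_fun K).1 hmem
    rw [← hc, map_sum]
    refine Finset.sum_eq_zero fun l _ => ?_
    rw [smul_eq_C_mul, map_mul, hμy l, mul_zero]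
  have hNt : N - 1 + 1 ≤ N := by omega
  -- `z` and `[x]` lie on `V₊(μ, λ)`
  have hzL : z ∈ ProjectiveSpectrum.zeroLocus (MvPolynomial.homogeneousSubmodule (Fin (N + 1)) K)
      (Set.range L) := by
    rintro _ ⟨j, rfl⟩
    refine Fin.lastCases ?_ (fun i => ?_) j
    · rw [hLlast]; exact hlamz
    · rw [hLcast]; exact hz ⟨i, rfl⟩
  have hxL : (pointOfVec K x hx0).pt ∈ ProjectiveSpectrum.zeroLocus
      (MvPolynomial.homogeneousSubmodule (Fin (N + 1)) K) (Set.range L) := by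
    rintro _ ⟨j, rfl⟩
    refine mem_asHomogeneousIdeal_pt_pointOfVec hx0 zero_lt_one (hLhom j) ?_
    refine Fin.lastCases ?_ (fun i => ?_) j
    · rw [hLlast]; exact hlamx
    · rw [hLcast]; exact hμx i
  -- `V₊(μ, λ)` is a single point
  have key : ∀ w : ↥(projectiveSpace N K).left,
      w ∈ ProjectiveSpectrum.zeroLocus (MvPolynomial.homogeneousSubmodule (Fin (N + 1)) K)
        (Set.range L) → w = linearSubspacePoint L hLlin hLhom hNt := by
    intro w hw
    by_contra hne
    have hlt := height_lt_of_mem_zeroLocus L hLlin hLhom hNt hw hne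
    have h0 : N - (N - 1 + 1) = 0 := by omega
    rw [h0, Nat.cast_zero] at hlt
    exact not_lt_zero hlt
  rw [key z hzL, key _ hxL]

/-! ### `V₊(λ) · [line] = [[x]]` -/

omit [Infinite K] in
/-- The generic point of the line `V₊(μ)` is a `1`-plane point of `ℙᴺ_K` (for `𝟙 ℙᴺ`). [folklore] -/
theorem isLinearSubspacePoint_one_linearSubspacePoint (hN : 1 ≤ N)
    {μ : Fin (N - 1) → MvPolynomial (Fin (N + 1)) K} (hμli : LinearIndependent K μ)
    (hμhom : ∀ l, (μ l).IsHomogeneous 1) :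
    IsLinearSubspacePoint 1 N (𝟙 (projectiveSpace N K))
      (linearSubspacePoint μ hμli hμhom (Nat.sub_le N 1)) := by
  have h := isLinearSubspacePoint_of_toIdeal_eq_span μ hμli hμhom (Nat.sub_le N 1)
    (toIdeal_linearSubspacePoint μ hμli hμhom (Nat.sub_le N 1))
  rwa [show N - (N - 1) = 1 by omega] at h

omit [Infinite K] in
/-- A form not vanishing at `y` is not in the prime of the line through `[x], [y]`. [folklore] -/
theorem notMem_asHomogeneousIdeal_linearSubspacePoint_of_eval_ne_zero
    {y : Fin (N + 1) → K} {μ : Fin (N - 1) → MvPolynomial (Fin (N + 1)) K}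
    (hμli : LinearIndependent K μ) (hμhom : ∀ l, (μ l).IsHomogeneous 1)
    (hμy : ∀ l, eval y (μ l) = 0) {G : MvPolynomial (Fin (N + 1)) K} (hGy : eval y G ≠ 0) :
    G ∉ ProjectiveSpectrum.asHomogeneousIdeal
      (𝒜 := MvPolynomial.homogeneousSubmodule (Fin (N + 1)) K)
      (linearSubspacePoint μ hμli hμhom (Nat.sub_le N 1)) := by
  intro h
  have h' : G ∈ (ProjectiveSpectrum.asHomogeneousIdeal
      (𝒜 := MvPolynomial.homogeneousSubmodule (Fin (N + 1)) K)
      (linearSubspacePoint μ hμli hμhom (Nat.sub_le N 1))).toIdeal := h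
  rw [toIdeal_linearSubspacePoint] at h'
  exact hGy (eval_eq_zero_of_mem_idealSpan hμy h')

omit [Infinite K] in
/-- **`V₊(λ) · [V₊(μ)] = [[x]]`**: a hyperplane through `[x]` but not containing the line `V₊(μ)`
through `[x], [y]` (i.e. `λ(x) = 0 ≠ λ(y)`) meets it in the reduced point `[x]` (multiplicity one:
`Motives/ProjectiveSpaceHyperplaneMultiplicity`, Fulton Example 2.5.1). [cite: Fulton1998, Example 2.5.1 (p. 41)] -/
theorem primeInter_formDivisor_linear_line_eq_primeCycle (hN : 1 ≤ N) {x y : Fin (N + 1) → K}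
    (hx0 : x ≠ 0) {μ : Fin (N - 1) → MvPolynomial (Fin (N + 1)) K} (hμli : LinearIndependent K μ)
    (hμhom : ∀ l, (μ l).IsHomogeneous 1) (hμx : ∀ l, eval x (μ l) = 0) (hμy : ∀ l, eval y (μ l) = 0)
    {lam : MvPolynomial (Fin (N + 1)) K} (hlam : lam ∈ grading (Fin (N + 1)) K 1) (hlam0 : lam ≠ 0)
    (hlamx : eval x lam = 0) (hlamy : eval y lam ≠ 0) :
    (formDivisor lam hlam hlam0).primeInter (X := projectiveSpace N K)
        (linearSubspacePoint μ hμli hμhom (Nat.sub_le N 1)) =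
      primeCycle (pointOfVec K x hx0).pt := by
  classical
  have hlamhom : lam.IsHomogeneous 1 := (mem_homogeneousSubmodule 1 lam).1 hlam
  have hlamw := notMem_asHomogeneousIdeal_linearSubspacePoint_of_eval_ne_zero hμli hμhom hμy hlamy
  obtain ⟨w', -, hprime⟩ := exists_primeInter_formDivisor_eq_primeCycle_of_isLinearSubspacePoint
    le_rfl (isLinearSubspacePoint_one_linearSubspacePoint hN hμli hμhom) hlam hlam0 hlamw
  -- identify `w'` with `[x]`: it lies on the line and on `V₊(λ)`
  have hne : (formDivisor lam hlam hlam0).primeInter (X := projectiveSpace N K)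
      (linearSubspacePoint μ hμli hμhom (Nat.sub_le N 1)) w' ≠ 0 := by
    rw [hprime, primeCycle_apply_self]; exact one_ne_zero
  have hww' : linearSubspacePoint μ hμli hμhom (Nat.sub_le N 1) ⤳ w' :=
    CartierDivisor.specializes_of_primeInter_ne_zero _ hne
  have hw'z : w' ∈ ProjectiveSpectrum.zeroLocus (MvPolynomial.homogeneousSubmodule (Fin (N + 1)) K)
      (Set.range μ) := by
    rw [← closure_linearSubspacePoint μ hμli hμhom (Nat.sub_le N 1)]
    exact specializes_iff_mem_closure.mp hww'
  have hlamw' : lam ∈ ProjectiveSpectrum.asHomogeneousIdeal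
      (𝒜 := MvPolynomial.homogeneousSubmodule (Fin (N + 1)) K) w' := by
    by_contra h
    exact CartierDivisor.not_avoids_of_primeInter_ne_zero _ hne
      ((formDivisor_avoids_iff hlam hlam0 zero_lt_one).2 h)
  rw [hprime, eq_pt_pointOfVec_of_mem_zeroLocus_line hN hx0 hμli hμhom hμx hμy hlamhom hlamx hlamy
    hw'z hlamw']

/-! ### `V₊(F) · [line] = 3 [[x]]` for an osculating line -/

/-- **An osculating line meets the cubic in its point of contact with multiplicity `3`** (Mboro,
arXiv:1701.04488, Lemma 1.1 and proof of Thm. 1.2, Case 2: "intersects `X` at `x` with multiplicity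
`d`"), as an identity of cycles on `ℙᴺ_K`: for independent `x, y ∈ Kᴺ⁺¹` and a cubic form `F` with
`F(s x + t y) = t³ F(y)` for all `s, t` (the line `[x][y]` osculates `V₊(F)` to order `3` at `[x]`)
and `F(y) ≠ 0` (the line is not on `V₊(F)`), the intersection cycle of `V₊(F)` with the line
`V₊(μ)` (`μ` its `N - 1` equations, vanishing at `x` and `y` and generating the ideal of forms
vanishing on `span(x, y)`) is `3 · [[x]]`. Proof: `F - c λ³ ∈ (μ) = 𝔭_{V₊(μ)}` for a linear `λ`
with `λ(x) = 0 ≠ λ(y)` and `c = F(y)/λ(y)³` (both sides agree on `span(x, y)`), so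
`V₊(F) · [V₊(μ)] = V₊((cλ) λ λ) · [V₊(μ)] = Σ V₊(·) · [V₊(μ)] = 3 [[x]]`.
[cite: Mboro2018, Lemma 1.1 (p. 6) and proof of Thm. 1.2, Case 2 (arXiv:1701.04488, p. 7)] [cite: Fulton1998, Def. 2.3 and Prop. 2.3 (b)] -/
theorem primeInter_formDivisor_line_eq_three_smul (hN : 1 ≤ N) {x y : Fin (N + 1) → K}
    (hxy : LinearIndependent K ![x, y])
    {F : MvPolynomial (Fin (N + 1)) K} (hF : F ∈ grading (Fin (N + 1)) K 3) (hF0 : F ≠ 0)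
    (hosc : ∀ s t : K, eval (s • x + t • y) F = t ^ 3 * eval y F) (hFy : eval y F ≠ 0)
    {μ : Fin (N - 1) → MvPolynomial (Fin (N + 1)) K} (hμli : LinearIndependent K μ)
    (hμhom : ∀ l, (μ l).IsHomogeneous 1) (hμx : ∀ l, eval x (μ l) = 0) (hμy : ∀ l, eval y (μ l) = 0)
    (hμideal : ∀ G : MvPolynomial (Fin (N + 1)) K,
      (∀ s t : K, eval (s • x + t • y) G = 0) → G ∈ Ideal.span (Set.range μ)) :
    (formDivisor F hF hF0).primeInter (X := projectiveSpace N K)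
        (linearSubspacePoint μ hμli hμhom (Nat.sub_le N 1)) =
      3 • primeCycle (pointOfVec K x (by simpa using hxy.ne_zero 0)).pt := by
  classical
  have hx0 : x ≠ 0 := by simpa using hxy.ne_zero 0
  obtain ⟨lam, hlamhom, hlamx, hlamy⟩ := exists_linearForm_eval_eq_zero_ne_zero hN hxy
  have hlam : lam ∈ grading (Fin (N + 1)) K 1 := (mem_homogeneousSubmodule 1 lam).2 hlamhom
  have hlam0 : lam ≠ 0 := by rintro rfl; exact hlamy (map_zero _)
  set w := linearSubspacePoint μ hμli hμhom (Nat.sub_le N 1) with hw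
  -- the constant `c = F(y)/λ(y)³` and the linear form `c λ`
  set c : K := eval y F / eval y lam ^ 3 with hc
  have hc0 : c ≠ 0 := div_ne_zero hFy (pow_ne_zero 3 hlamy)
  have hclam : C c * lam ∈ grading (Fin (N + 1)) K 1 := by
    have h := Submodule.smul_mem (grading (Fin (N + 1)) K 1) c hlam
    rwa [smul_eq_C_mul] at h
  have hclam0 : C c * lam ≠ 0 := mul_ne_zero (by rwa [Ne, C_eq_zero]) hlam0
  have hclamx : eval x (C c * lam) = 0 := by rw [map_mul, hlamx, mul_zero]
  have hclamy : eval y (C c * lam) ≠ 0 := by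
    rw [map_mul, eval_C]; exact mul_ne_zero hc0 hlamy
  -- `F - (cλ)λλ` vanishes on `span(x, y)`, hence lies in `𝔭_w = (μ)`
  have hlamline : ∀ s t : K, eval (s • x + t • y) lam = t * eval y lam := by
    intro s t
    rw [eval_add_smul_of_isHomogeneous_one hlamhom, hlamx, mul_zero, zero_add]
  have hdiff : F - C c * lam * lam * lam ∈ ProjectiveSpectrum.asHomogeneousIdeal
      (𝒜 := MvPolynomial.homogeneousSubmodule (Fin (N + 1)) K) w := by
    change F - C c * lam * lam * lam ∈ (ProjectiveSpectrum.asHomogeneousIdeal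
      (𝒜 := MvPolynomial.homogeneousSubmodule (Fin (N + 1)) K) w).toIdeal
    rw [hw, toIdeal_linearSubspacePoint]
    refine hμideal _ fun s t => ?_
    simp only [map_sub, map_mul, eval_C, hosc s t, hlamline s t]
    rw [hc]
    field_simp
    ring
  -- non-membership in `𝔭_w` of `F`, `λ`, `cλ`
  have hFw := notMem_asHomogeneousIdeal_linearSubspacePoint_of_eval_ne_zero hμli hμhom hμy hFy
  have hlamw := notMem_asHomogeneousIdeal_linearSubspacePoint_of_eval_ne_zero hμli hμhom hμy hlamy
  have hclamw := notMem_asHomogeneousIdeal_linearSubspacePoint_of_eval_ne_zero hμli hμhom hμy hclamy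
  have hcl2y : eval y (C c * lam * lam) ≠ 0 := by
    rw [map_mul]; exact mul_ne_zero hclamy hlamy
  have hcl2w := notMem_asHomogeneousIdeal_linearSubspacePoint_of_eval_ne_zero hμli hμhom hμy hcl2y
  -- `V₊(F) · [w] = V₊((cλ)λλ) · [w] = V₊(cλ)·[w] + V₊(λ)·[w] + V₊(λ)·[w] = 3 [[x]]`
  have hG : C c * lam * lam * lam ∈ grading (Fin (N + 1)) K 3 :=
    SetLike.mul_mem_graded (SetLike.mul_mem_graded hclam hlam) hlam
  have hG0 : C c * lam * lam * lam ≠ 0 := mul_ne_zero (mul_ne_zero hclam0 hlam0) hlam0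
  rw [primeInter_formDivisor_congr (by norm_num) hF hF0 hG hG0 hFw hdiff,
    primeInter_formDivisor_mul (by norm_num) one_pos (SetLike.mul_mem_graded hclam hlam)
      (mul_ne_zero hclam0 hlam0) hlam hlam0 hcl2w hlamw,
    primeInter_formDivisor_mul one_pos one_pos hclam hclam0 hlam hlam0 hclamw hlamw,
    primeInter_formDivisor_linear_line_eq_primeCycle hN hx0 hμli hμhom hμx hμy hclam hclam0 hclamx hclamy,
    primeInter_formDivisor_linear_line_eq_primeCycle hN hx0 hμli hμhom hμx hμy hlam hlam0 hlamx hlamy]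
  rw [show (3 : ℕ) = 1 + 1 + 1 from rfl, add_nsmul, add_nsmul, one_nsmul]

end ProjSpace

end Literature.AlgebraicGeometry.Motives

end
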